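import Mathlib.LinearAlgebra.ExteriorAlgebra.Basic
import Summits.Ventures.HodgeRepro2.T6A2WeilRing

/-!
# T6A2WeilFull — the full cohomology ring of a host Weil cohomology and the exterior-algebra map `⋀ H¹ → H^*`

Cell pub-hodge-repro2, Tier 6 (README §10), seat t6-p2 (A2 host side). For `W : WeilCohomology k ℚ` and a
smooth projective `P`, the full graded ring `FullRing W P := ⨁ i, W.obj P.X i` (all degrees, the cup product;
associative and unital by the host's `cup_assoc` / `one_cup` / `cup_comm`, graded-commutative with the Koszul
sign — NOT commutative), the degree-one inclusion `ι₁`, the identity `ι₁ a * ι₁ a = 0` (the sign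
`(−1)^{1·1}` of `cup_comm` in characteristic `0`), and **`langeMap : ExteriorAlgebra ℚ (W.obj P.X 1) →ₐ[ℚ]
FullRing W P`** — the universal map `⋀ H¹(X) → H^*(X)` of the exterior algebra (`ExteriorAlgebra.lift`).
For an abelian variety this map is an isomorphism (Lange–Birkenhake Cor. 1.1.19 / Prop. 1.1.20 — the A1
display of TARGET-T6 §3 row H6, to be stated over this carrier by the Layer-III owner); through it the
interface's `HB K = ⋀ H1 K` is identified with the host's cohomology (the `IdentB.ev` of T6A2Shadow).
No `sorry`; standard axioms.
§8(d): uses an L-value-free non-vanishing device: NO.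
-/

noncomputable section

namespace Summit.Ventures.HodgeRepro2.T6.WeilInst

open HostAPI.Carriers.AlgebraicGeometry.Motives CategoryTheory Opposite
open scoped DirectSum

universe u

variable {k : Type u} [Field k] (W : WeilCohomology k ℚ) (P : SPVar k)

/-- all the pieces `H^i(X)` -/
abbrev Full (X : SchemeOver k) (i : ℕ) : Type u := W.obj X i

/-- the graded multiplication of the full ring -/
instance instGMulFull : GradedMonoid.GMul (Full W P.X) := ⟨fun {_ _} a b => W.cup rfl a b⟩

/-- the graded unit of the full ring -/
instance instGOneFull : GradedMonoid.GOne (Full W P.X) := ⟨W.one P.X⟩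

/-- the full graded ring structure: associative, unital, NOT commutative -/
instance instGRingFull : DirectSum.GRing (Full W P.X) where
  mul_zero {_ j} a := by
    show W.cup _ a (0 : Full W P.X j) = 0
    simp
  zero_mul {i _} b := by
    show W.cup _ (0 : Full W P.X i) b = 0
    simp
  mul_add {_ _} a b c := by
    show W.cup _ a (b + c) = W.cup _ a b + W.cup _ a c
    simp
  add_mul {_ _} a b c := by
    show W.cup _ (a + b) c = W.cup _ a c + W.cup _ b c
    simp
  one_mul := by
    rintro ⟨i, a⟩
    refine Sigma.ext (by simp) ?_
    show HEq (W.cup _ (W.one P.X) a) a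
    exact (cup_heq W _ (by omega : 0 + i = i) _ _).trans (heq_of_eq (W.one_cup P.smooth _ a))
  mul_one := by
    rintro ⟨i, a⟩
    refine Sigma.ext (by simp) ?_
    show HEq (W.cup _ a (W.one P.X)) a
    rw [W.cup_comm P.smooth (rfl : i + 0 = i + 0) (by omega : 0 + i = i + 0) a (W.one P.X)]
    simp only [Nat.cast_zero, mul_zero, Int.negOnePow_zero, Units.val_one, one_smul]
    exact (cup_heq W _ (by omega : 0 + i = i) _ _).trans (heq_of_eq (W.one_cup P.smooth _ a))
  mul_assoc := by
    rintro ⟨i, a⟩ ⟨j, b⟩ ⟨l, c⟩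
    refine Sigma.ext (by simp [add_assoc]) ?_
    show HEq (W.cup _ (W.cup _ a b) c) (W.cup _ a (W.cup _ b c))
    refine (cup_heq W _ (by omega : i + j + l = i + (j + l)) _ _).trans ?_
    exact heq_of_eq (W.cup_assoc P.smooth _ _ _ _ a b c)
  natCast n := n • W.one P.X
  natCast_zero := zero_smul _ _
  natCast_succ n := succ_nsmul _ _
  intCast n := n • W.one P.X
  intCast_ofNat n := natCast_zsmul _ _
  intCast_negSucc_ofNat n := negSucc_zsmul _ _

/-- the `ℚ`-algebra structure of the full ring -/
instance instGAlgebraFull : DirectSum.GAlgebra ℚ (Full W P.X) where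
  toFun :=
    { toFun := fun r => r • W.one P.X
      map_zero' := zero_smul _ _
      map_add' := fun r s => add_smul r s _ }
  map_one := one_smul _ _
  map_mul r s := by
    refine Sigma.ext rfl ?_
    apply heq_of_eq
    show (r * s) • W.one P.X = W.cup (show (0 : ℕ) + 0 = 0 from rfl) (r • W.one P.X) (s • W.one P.X)
    rw [map_smul, LinearMap.map_smul₂, W.one_cup P.smooth rfl (W.one P.X), smul_smul, mul_comm]
  commutes r := by
    rintro ⟨i, a⟩
    refine Sigma.ext (by simp [add_comm]) ?_
    show HEq (W.cup _ (r • W.one P.X) a) (W.cup _ a (r • W.one P.X))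
    have hc : W.cup (rfl : 0 + i = 0 + i) (r • W.one P.X) a =
        W.cup (by omega : i + 0 = 0 + i) a (r • W.one P.X) := by
      rw [W.cup_comm P.smooth rfl (by omega) (r • W.one P.X) a]
      simp only [Nat.cast_zero, zero_mul, Int.negOnePow_zero, Units.val_one, one_smul]
    exact (heq_of_eq hc).trans (cup_heq W _ (rfl : i + 0 = i + 0) _ _)
  smul_def r := by
    rintro ⟨i, a⟩
    refine Sigma.ext ?_ ?_
    · rw [GradedMonoid.fst_smul]
      show i = 0 + i
      simp
    · rw [GradedMonoid.snd_smul]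
      show HEq (r • a) (W.cup _ (r • W.one P.X) a)
      refine HEq.trans ?_ (cup_heq W (by omega : 0 + i = i) (rfl : 0 + i = 0 + i) _ _)
      apply heq_of_eq
      rw [LinearMap.map_smul₂, W.one_cup P.smooth _ a]

/-- THE FULL COHOMOLOGY RING `H^*(X, ℚ) = ⨁_i H^i(X)` with the cup product. -/
abbrev FullRing : Type u := ⨁ i, Full W P.X i

example : Ring (FullRing W P) := inferInstance
example : Algebra ℚ (FullRing W P) := inferInstance

/-- the degree-`i` inclusion into the full ring -/
abbrev ofDegF (i : ℕ) : Full W P.X i →ₗ[ℚ] FullRing W P := DirectSum.lof ℚ ℕ (Full W P.X) i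

/-- the product of homogeneous elements of the full ring is the cup product -/
theorem ofDegF_mul_ofDegF {i j : ℕ} (a : Full W P.X i) (b : Full W P.X j) :
    ofDegF W P i a * ofDegF W P j b = ofDegF W P (i + j) (W.cup rfl a b) := by
  simp only [ofDegF, DirectSum.lof_eq_of]
  exact DirectSum.of_mul_of _ _

/-- the degree-one inclusion `H¹(X) → H^*(X)` -/
abbrev ι₁ : W.obj P.X 1 →ₗ[ℚ] FullRing W P := ofDegF W P 1

/-- `a ∪ a = 0` for a class of degree one: the Koszul sign `(−1)^{1·1}` in characteristic `0` -/
theorem cup_self_eq_zero (a : W.obj P.X 1) : W.cup (rfl : 1 + 1 = 1 + 1) a a = 0 := by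
  have h := W.cup_comm P.smooth (rfl : 1 + 1 = 1 + 1) rfl a a
  have hsign : (((1 : ℕ) * (1 : ℕ) : ℤ).negOnePow : ℤ) = -1 := by decide
  rw [hsign, neg_one_zsmul] at h
  have h2 : (2 : ℚ) • W.cup (rfl : 1 + 1 = 1 + 1) a a = 0 := by
    rw [two_smul]
    exact add_eq_zero_iff_eq_neg.2 h
  exact (smul_eq_zero.1 h2).resolve_left two_ne_zero

/-- `ι₁ a * ι₁ a = 0` -/
theorem ι₁_mul_ι₁ (a : W.obj P.X 1) : ι₁ W P a * ι₁ W P a = 0 := by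
  rw [ι₁, ofDegF_mul_ofDegF, cup_self_eq_zero, map_zero]

/-- THE EXTERIOR-ALGEBRA MAP `⋀ H¹(X) → H^*(X)` (Lange–Birkenhake's isomorphism for an abelian variety, as
a map; its bijectivity is the A1 display). -/
def langeMap : ExteriorAlgebra ℚ (W.obj P.X 1) →ₐ[ℚ] FullRing W P :=
  ExteriorAlgebra.lift ℚ ⟨ι₁ W P, ι₁_mul_ι₁ W P⟩

/-- `langeMap` on the generators -/
@[simp] theorem langeMap_ι (a : W.obj P.X 1) : langeMap W P (ExteriorAlgebra.ι ℚ a) = ι₁ W P a := by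
  simp [langeMap]

end Summit.Ventures.HodgeRepro2.T6.WeilInst

end
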